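/-
Origin: expansion seat `planner-pub-hodgecm-pv06-g4-0`, handover #3 2026-08-18T08:22:14Z (`HOME/pub-hodgecm-pv06-g4/lean/Pv06g4/AdelicUnitaryFactorisation.lean`, md5 17a46a73, 366 lines);
landed by the gen-7 packager in gate run 26 as `HodgeCM/PerL34/AdelicUnitaryFactorisation.lean` (import ^import Prl1g4\.→import HodgeCM.Automorphic. ×1; import ^import Pv[0-9]+g[0-9]+\.→import HodgeCM.PerL34. ×2).
-/
/-
Copyright (c) 2026. All rights reserved.
Released under Apache 2.0 license as described in the file LICENSE.
Cell pub-hodgecm, seat pv06-g4 (DAG-NODE PROVER #06, generation 4).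
-/
import Summits.HodgeConjecture.HodgeCM.Automorphic.AdelicUnitaryGroup
import Summits.HodgeConjecture.HodgeCM.PerL34.GLProd
import Summits.HodgeConjecture.HodgeCM.PerL34.InfiniteAdeleComplex
import Summits.HodgeConjecture.HodgeCM.PerL34.AnnihilationDense

/-!
# The D3 dictionary for the genuine adelic unitary group: `U(H)(𝔸_{L⁺}) ≃ₜ* ∏_{w ∣ ∞} U(H_w) × U(H)(𝔸_{L⁺,f})`

PerL v5, Prop. 3.6 Step 2 (tex ll. 423–433), torus side of DAG node N23c: the compact-torus model of the
theta lift needs, over the GENUINE adelic unitary group `G = U(H)(𝔸_{L⁺})` of prl1-g4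
(`HodgeCM.Adelic.adelicUnitaryGroup L H ≤ GL_n(𝔸_L)`, the fixed points of `g ↦ (c ⊗ 1)(g)⁻ᵀ`-twisted by `H`)
with its rational points `Γ = U(H)(L⁺)` (`HodgeCM.Adelic.adelicUnitaryRat`), the four fields
`Gf`, `ιf`, `comm`, `dense` of `CompactTorusModelData` (pv06-g3) / `CompactInput` (pv15-g2).

pv06-g2's `HodgeCM.Literature.RealApproximation.dense_cosets_of_dictionary` (tree file
`HodgeCM/PerL34/AnnihilationDense.lean`) proves `dense` for ANY topological group `G` handed with a DICTIONARY
`e : G ≃ₜ* (∏_{w ∣ ∞} U(H_w)) × Gf` such that `ιf` is the inclusion of the second factor and every rational unitary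
matrix `g ∈ U(H)(L⁺) ≤ GL_n(L)` has a lift `γ ∈ Γ` whose archimedean image is `(w(g))_w`. This file CONSTRUCTS that
dictionary for the genuine group (no hypotheses besides `ᵗH̄ = H` and `det H ≠ 0`):

* §1 `infConj`, `finConj`: the conjugation `c ⊗ id` on the two factors of `𝔸_L = L_∞ × 𝔸_{L,f}`
  (`adeleConj L = infConj L × finConj L`, definitional);
* §2 `matPi : M_n(L_∞) ≃+* ∏_{w ∣ ∞} M_n(ℂ)` (entrywise `InfiniteAdeleComplex.piComplex`: `L_w = ℂ` at every
  (complex) place of the CM field `L`), bicontinuous;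
* §3 `Uinf L H ≤ GL_n(L_∞)`, `Ufin L H ≤ GL_n(𝔸_{L,f})` and the split
  `splitEquiv : U(H)(𝔸_{L⁺}) ≃ₜ* Uinf × Ufin` (`GLProd.unitaryProdEquiv`: `GL_n(R × S) = GL_n(R) × GL_n(S)` and the
  unitarity relation is checked componentwise);
* §4 `archEquiv : Uinf L H ≃ₜ* unitaryPiSubmonoid L H = ∏_{w ∣ ∞} U(H_w)`: under `matPi`, `c ⊗ id` becomes entrywise
  complex conjugation at every place (`InfiniteAdeleComplex.coordHom_complexConj_smul`: `c` fixes every infinite place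
  of a CM field and acts on `L_w = ℂ` as `conj`) and `H ⊗ 1` becomes `(w(H))_w`, so the defining relation
  `ᵗ(c ⊗ 1)(g) · H · g = H` becomes `g_w^* H_w g_w = H_w` for all `w`;
* §5 the dictionary `archFinEquiv := splitEquiv ≫ (archEquiv × id)`, the inclusion `ιf : Ufin →* U(H)(𝔸_{L⁺})`,
  the lift property `exists_rat_lift` (the diagonal embedding `toAdeleGL` of prl1-g4), and the two deliverables
  **`dense_cosets`** (N23c `dense`) and **`ιf_comm`** (N23c `comm`: the finite factor commutes with everything whose
  finite component is `1`, in particular with the archimedean torus).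

Everything here is kernel mathematics over Mathlib + the package; no proposition of PerL is assumed.
References for the underlying facts: [PlatonovRapinchuk1994, §5.1 (adelic points of algebraic groups as restricted
products; `G(𝔸) = G_∞ × G(𝔸_f)`)], [Kneser1966, Approximationssätze] (used only inside `AnnihilationDense`).
-/

set_option autoImplicit false

noncomputable section

open NumberField NumberField.InfinitePlace IsDedekindDomain Topology
open Literature.NumberTheory.Automorphic
open Literature.AlgebraicGeometry.ShimuraVarieties (unitaryGroup conjRingHomK)
open HodgeCM.Adelic HodgeCM.PerL34.GLProd HodgeCM.PerL34.InfiniteAdeleComplex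
open HodgeCM.Literature.RealApproximation
open scoped Matrix ComplexConjugate

namespace HodgeCM.PerL34.AdelicUnitaryFactorisation

variable (L : Type) [Field L] [NumberField L] [IsCMField L]

/-- The CM field `L`, bundled as a `HodgeCM.CMField` (the input format of `HodgeCM.Literature.RealApproximation`). -/
abbrev cm : CMField := ⟨L⟩

/-! ## §1 The conjugation `c ⊗ id` on the two factors of `𝔸_L` -/

/-- `c ⊗ id` on `L_∞ = ∏_{w ∣ ∞} L_w`. -/
def infConj : InfiniteAdeleRing L →+* InfiniteAdeleRing L :=
  MulSemiringAction.toRingHom (L ≃ₐ[↥(maximalRealSubfield L)] L) (InfiniteAdeleRing L) (IsCMField.complexConj L)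

/-- (Ported verbatim from the HodgeCMPerL package; no docstring in the source.) -/
@[simp] theorem infConj_apply (x : InfiniteAdeleRing L) : infConj L x = (IsCMField.complexConj L) • x := rfl

/-- (Ported verbatim from the HodgeCMPerL package; no docstring in the source.) -/
theorem continuous_infConj : Continuous (infConj L) :=
  InfiniteAdeleRing.continuous_smul (↥(maximalRealSubfield L)) (IsCMField.complexConj L)

/-- `c ⊗ id` on `𝔸_{L,f}`. -/
def finConj : FiniteAdeleRing (𝓞 L) L →+* FiniteAdeleRing (𝓞 L) L :=
  MulSemiringAction.toRingHom (L ≃ₐ[↥(maximalRealSubfield L)] L) (FiniteAdeleRing (𝓞 L) L)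
    (IsCMField.complexConj L)

/-- (Ported verbatim from the HodgeCMPerL package; no docstring in the source.) -/
@[simp] theorem finConj_apply (x : FiniteAdeleRing (𝓞 L) L) :
    finConj L x = (IsCMField.complexConj L) • x := rfl

/-- (Ported verbatim from the HodgeCMPerL package; no docstring in the source.) -/
theorem continuous_finConj : Continuous (finConj L) :=
  FiniteAdeleRing.continuous_smul L (IsCMField.complexConj L)

/-- (Ported verbatim from the HodgeCMPerL package; no docstring in the source.) -/
theorem adeleConj_fst (a : AdeleRing (𝓞 L) L) : (adeleConj L a).1 = infConj L a.1 := rfl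

/-- (Ported verbatim from the HodgeCMPerL package; no docstring in the source.) -/
theorem adeleConj_snd (a : AdeleRing (𝓞 L) L) : (adeleConj L a).2 = finConj L a.2 := rfl

/-! ## §2 `M_n(L_∞) ≃+* ∏_{w ∣ ∞} M_n(ℂ)` -/

section MatPi

variable (n : Type) [Fintype n] [DecidableEq n]

/-- `M_n(L_∞) ≃+* ∏_{w ∣ ∞} M_n(ℂ)`: `piComplex` entrywise, then regrouping (`Matrix.piRingEquiv`). -/
def matPi : Matrix n n (InfiniteAdeleRing L) ≃+* (InfinitePlace L → Matrix n n ℂ) :=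
  (piComplex L).mapMatrix.trans Matrix.piRingEquiv

/-- (Ported verbatim from the HodgeCMPerL package; no docstring in the source.) -/
@[simp] theorem matPi_apply (M : Matrix n n (InfiniteAdeleRing L)) (w : InfinitePlace L) :
    matPi L n M w = M.map (coordHom L w) := rfl

/-- (Ported verbatim from the HodgeCMPerL package; no docstring in the source.) -/
theorem matPi_symm_apply (u : InfinitePlace L → Matrix n n ℂ) (i j : n) :
    (matPi L n).symm u i j = (piComplex L).symm (fun w => u w i j) := rfl

/-- (Ported verbatim from the HodgeCMPerL package; no docstring in the source.) -/
theorem coe_matPi : ⇑(matPi L n) = fun M w => M.map (coordHom L w) := rfl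

/-- (Ported verbatim from the HodgeCMPerL package; no docstring in the source.) -/
theorem continuous_matPi : Continuous (matPi L n) := by
  rw [coe_matPi]
  exact continuous_pi fun w => continuous_id.matrix_map (continuous_coordHom L w)

/-- (Ported verbatim from the HodgeCMPerL package; no docstring in the source.) -/
theorem coe_matPi_symm :
    ⇑(matPi L n).symm = fun u => Matrix.of fun i j => (piComplex L).symm (fun w => u w i j) := rfl

/-- (Ported verbatim from the HodgeCMPerL package; no docstring in the source.) -/
theorem continuous_matPi_symm : Continuous (matPi L n).symm := by
  rw [coe_matPi_symm]
  exact continuous_matrix fun i j => (continuous_piComplex_symm L).comp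
    (continuous_pi fun w => (continuous_apply j).comp ((continuous_apply i).comp (continuous_apply w)))

/-- Under `matPi`, `ᵗ(c ⊗ 1)(M)` is the family of conjugate transposes. -/
theorem matPi_transpose_map_infConj (M : Matrix n n (InfiniteAdeleRing L)) (w : InfinitePlace L) :
    matPi L n ((M.map (infConj L))ᵀ) w = (matPi L n M w)ᴴ := by
  ext i j
  simp only [matPi_apply, Matrix.map_apply, Matrix.transpose_apply, Matrix.conjTranspose_apply, infConj_apply]
  rw [coordHom_complexConj_smul, Complex.star_def]

end MatPi

/-! ## §3 The split `U(H)(𝔸_{L⁺}) ≃ₜ* U(H)_∞ × U(H)(𝔸_{L⁺,f})` -/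

variable {n : Type} [Fintype n] [DecidableEq n] (H : Matrix n n L)

/-- `H ⊗ 1 ∈ M_n(𝔸_L)`. -/
def HA : Matrix n n (AdeleRing (𝓞 L) L) := H.map (algebraMap L (AdeleRing (𝓞 L) L))

omit [IsCMField L] [Fintype n] [DecidableEq n] in
/-- (Ported verbatim from the HodgeCMPerL package; no docstring in the source.) -/
theorem HA_map_fst : (HA L H).map Prod.fst = H.map (algebraMap L (InfiniteAdeleRing L)) := by
  rw [HA, Matrix.map_map]; rfl

omit [IsCMField L] [Fintype n] [DecidableEq n] in
/-- (Ported verbatim from the HodgeCMPerL package; no docstring in the source.) -/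
theorem HA_map_snd : (HA L H).map Prod.snd = H.map (algebraMap L (FiniteAdeleRing (𝓞 L) L)) := by
  rw [HA, Matrix.map_map]; rfl

/-- The archimedean unitary group `U(H)_∞ = U(H)(L⁺ ⊗ ℝ) ≤ GL_n(L_∞)`. -/
def Uinf : Subgroup (GL n (InfiniteAdeleRing L)) := unitaryGroup (infConj L) ((HA L H).map Prod.fst)

/-- The finite-adelic unitary group `U(H)(𝔸_{L⁺,f}) ≤ GL_n(𝔸_{L,f})` — the field `Gf` of N23c. -/
def Ufin : Subgroup (GL n (FiniteAdeleRing (𝓞 L) L)) := unitaryGroup (finConj L) ((HA L H).map Prod.snd)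

/-- (Ported verbatim from the HodgeCMPerL package; no docstring in the source.) -/
theorem mem_Ufin_iff (k : GL n (FiniteAdeleRing (𝓞 L) L)) :
    k ∈ Ufin L H ↔
      ((k : Matrix n n (FiniteAdeleRing (𝓞 L) L)).map (finConj L))ᵀ *
          H.map (algebraMap L (FiniteAdeleRing (𝓞 L) L)) * k = H.map (algebraMap L (FiniteAdeleRing (𝓞 L) L)) := by
  rw [Ufin, Literature.AlgebraicGeometry.ShimuraVarieties.mem_unitaryGroup_iff, HA_map_snd]

/-- (Ported verbatim from the HodgeCMPerL package; no docstring in the source.) -/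
theorem adelicUnitaryGroup_eq : adelicUnitaryGroup L H = unitaryGroup (adeleConj L) (HA L H) := rfl

/-- **Step 1.** `U(H)(𝔸_{L⁺}) ≃ₜ* U(H)_∞ × U(H)(𝔸_{L⁺,f})`: `GL_n(L_∞ × 𝔸_{L,f}) = GL_n(L_∞) × GL_n(𝔸_{L,f})` and the
unitarity relation for the componentwise conjugation `c ⊗ 1 = (c ⊗ 1) × (c ⊗ 1)` is checked componentwise. -/
def splitEquiv : adelicUnitaryGroup L H ≃ₜ* Uinf L H × Ufin L H :=
  unitaryProdEquiv (adeleConj_fst L) (adeleConj_snd L) (HA L H)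

/-- (Ported verbatim from the HodgeCMPerL package; no docstring in the source.) -/
@[simp] theorem val_splitEquiv_fst (g : adelicUnitaryGroup L H) :
    (((splitEquiv L H g).1 : GL n (InfiniteAdeleRing L)) : Matrix n n (InfiniteAdeleRing L)) =
      ((g : GL n (AdeleRing (𝓞 L) L)) : Matrix n n (AdeleRing (𝓞 L) L)).map Prod.fst := rfl

/-- (Ported verbatim from the HodgeCMPerL package; no docstring in the source.) -/
@[simp] theorem val_splitEquiv_snd (g : adelicUnitaryGroup L H) :
    (((splitEquiv L H g).2 : GL n (FiniteAdeleRing (𝓞 L) L)) : Matrix n n (FiniteAdeleRing (𝓞 L) L)) =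
      ((g : GL n (AdeleRing (𝓞 L) L)) : Matrix n n (AdeleRing (𝓞 L) L)).map Prod.snd := rfl

/-- (Ported verbatim from the HodgeCMPerL package; no docstring in the source.) -/
theorem val_splitEquiv_symm_apply (p : Uinf L H × Ufin L H) (i j : n) :
    (((splitEquiv L H).symm p : GL n (AdeleRing (𝓞 L) L)) : Matrix n n (AdeleRing (𝓞 L) L)) i j =
      (((p.1 : GL n (InfiniteAdeleRing L)) : Matrix n n (InfiniteAdeleRing L)) i j,
        ((p.2 : GL n (FiniteAdeleRing (𝓞 L) L)) : Matrix n n (FiniteAdeleRing (𝓞 L) L)) i j) := rfl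

/-! ## §4 `U(H)_∞ ≃ₜ* ∏_{w ∣ ∞} U(H_w)` -/

/-- (Ported verbatim from the HodgeCMPerL package; no docstring in the source.) -/
theorem matPi_HA_fst (w : InfinitePlace L) : matPi L n ((HA L H).map Prod.fst) w = H.map w.embedding := by
  ext i j
  simp only [matPi_apply, Matrix.map_apply, HA]
  exact coordHom_algebraMap L w (H i j)

/-- The unitarity relation of `U(H)_∞` is, place by place, `g_w^* · w(H) · g_w = w(H)`. -/
theorem mem_Uinf_iff (g : GL n (InfiniteAdeleRing L)) :
    g ∈ Uinf L H ↔ matPi L n (g : Matrix n n (InfiniteAdeleRing L)) ∈ unitaryPiSubmonoid (cm L) H := by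
  rw [Uinf, Literature.AlgebraicGeometry.ShimuraVarieties.mem_unitaryGroup_iff, mem_unitaryPiSubmonoid_iff,
    ← (matPi L n).injective.eq_iff, funext_iff]
  refine forall_congr' fun w => ?_
  rw [map_mul, map_mul, Pi.mul_apply, Pi.mul_apply, matPi_HA_fst, matPi_transpose_map_infConj]

variable {H}

/-- The forward map `U(H)_∞ → ∏_w U(H_w)`, `g ↦ (g_w)_w`. -/
def archFun (g : Uinf L H) : unitaryPiSubmonoid (cm L) H :=
  ⟨matPi L n (g : GL n (InfiniteAdeleRing L)), (mem_Uinf_iff L H g).1 g.2⟩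

/-- (Ported verbatim from the HodgeCMPerL package; no docstring in the source.) -/
theorem continuous_archFun : Continuous (archFun L (H := H)) :=
  ((continuous_matPi L n).comp (Units.continuous_val.comp continuous_subtype_val)).subtype_mk _

/-- (Ported verbatim from the HodgeCMPerL package; no docstring in the source.) -/
theorem coe_invFamily_eq :
    (invFamily (cm L) H : (InfinitePlace L → Matrix n n ℂ) → InfinitePlace L → Matrix n n ℂ) =
      fun u w => (H.map w.embedding)⁻¹ * (u w)ᴴ * H.map w.embedding := rfl

/-- (Ported verbatim from the HodgeCMPerL package; no docstring in the source.) -/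
theorem continuous_invFamily :
    Continuous (invFamily (cm L) H : (InfinitePlace L → Matrix n n ℂ) → InfinitePlace L → Matrix n n ℂ) := by
  rw [coe_invFamily_eq]
  exact continuous_pi fun w =>
    (continuous_const.matrix_mul (continuous_apply w).matrix_conjTranspose).matrix_mul continuous_const

/-- The inverse map on matrices: `(u_w)_w ↦ matPi⁻¹ u ∈ GL_n(L_∞)`, with inverse `matPi⁻¹ (H_w⁻¹ u_w^* H_w)_w`
(needs `det H ≠ 0`). -/
def archInvGL (hdet : IsUnit H.det) (u : unitaryPiSubmonoid (cm L) H) : GL n (InfiniteAdeleRing L) where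
  val := (matPi L n).symm u
  inv := (matPi L n).symm (invFamily (cm L) H u)
  val_inv := by
    rw [← map_mul, ← map_one (matPi L n).symm]
    exact congrArg _ (funext fun w => mul_invFamily (cm L) H hdet u.2 w)
  inv_val := by
    rw [← map_mul, ← map_one (matPi L n).symm]
    exact congrArg _ (funext fun w => invFamily_mul (cm L) H hdet u.2 w)

/-- (Ported verbatim from the HodgeCMPerL package; no docstring in the source.) -/
@[simp] theorem val_archInvGL (hdet : IsUnit H.det) (u : unitaryPiSubmonoid (cm L) H) :
    (archInvGL L hdet u : Matrix n n (InfiniteAdeleRing L)) = (matPi L n).symm u := rfl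

/-- (Ported verbatim from the HodgeCMPerL package; no docstring in the source.) -/
theorem archInvGL_mem (hdet : IsUnit H.det) (u : unitaryPiSubmonoid (cm L) H) : archInvGL L hdet u ∈ Uinf L H := by
  rw [mem_Uinf_iff, val_archInvGL, RingEquiv.apply_symm_apply]
  exact u.2

/-- The inverse map `∏_w U(H_w) → U(H)_∞`. -/
def archInv (hdet : IsUnit H.det) (u : unitaryPiSubmonoid (cm L) H) : Uinf L H :=
  ⟨archInvGL L hdet u, archInvGL_mem L hdet u⟩

/-- (Ported verbatim from the HodgeCMPerL package; no docstring in the source.) -/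
theorem continuous_archInvGL (hdet : IsUnit H.det) : Continuous (archInvGL L hdet) :=
  (Units.continuous_iff (f := archInvGL L hdet)).2
    ⟨(continuous_matPi_symm L n).comp continuous_subtype_val,
      (continuous_matPi_symm L n).comp ((continuous_invFamily L).comp continuous_subtype_val)⟩

/-- (Ported verbatim from the HodgeCMPerL package; no docstring in the source.) -/
theorem continuous_archInv (hdet : IsUnit H.det) : Continuous (archInv L hdet) :=
  (continuous_archInvGL L hdet).subtype_mk _

/-- **Step 2.** `U(H)_∞ ≃ₜ* ∏_{w ∣ ∞} U(H_w)` (`det H ≠ 0`). -/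
def archEquiv (hdet : IsUnit H.det) : Uinf L H ≃ₜ* unitaryPiSubmonoid (cm L) H :=
  { toFun := archFun L
    invFun := archInv L hdet
    left_inv := fun g => Subtype.ext (Units.ext ((matPi L n).symm_apply_apply _))
    right_inv := fun u => Subtype.ext ((matPi L n).apply_symm_apply _)
    map_mul' := fun g h => Subtype.ext (by
      change matPi L n ((g : GL n (InfiniteAdeleRing L)) * h : GL n (InfiniteAdeleRing L)) = _
      rw [Units.val_mul, map_mul]; rfl)
    continuous_toFun := continuous_archFun L
    continuous_invFun := continuous_archInv L hdet }

/-- (Ported verbatim from the HodgeCMPerL package; no docstring in the source.) -/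
@[simp] theorem coe_archEquiv_apply (hdet : IsUnit H.det) (g : Uinf L H) :
    ((archEquiv L hdet g : unitaryPiSubmonoid (cm L) H) : InfinitePlace L → Matrix n n ℂ) =
      matPi L n (g : GL n (InfiniteAdeleRing L)) := rfl

/-! ## §5 The dictionary, `ιf`, the rational lift, `dense` and `comm` -/

section ProdCongr

variable {A B C D : Type*} [MulOneClass A] [MulOneClass B] [MulOneClass C] [MulOneClass D]
  [TopologicalSpace A] [TopologicalSpace B] [TopologicalSpace C] [TopologicalSpace D]

/-- Product of continuous multiplicative equivalences. -/
def prodCongrCME (e₁ : A ≃ₜ* B) (e₂ : C ≃ₜ* D) : A × C ≃ₜ* B × D where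
  toFun p := (e₁ p.1, e₂ p.2)
  invFun q := (e₁.symm q.1, e₂.symm q.2)
  left_inv p := Prod.ext (e₁.symm_apply_apply p.1) (e₂.symm_apply_apply p.2)
  right_inv q := Prod.ext (e₁.apply_symm_apply q.1) (e₂.apply_symm_apply q.2)
  map_mul' p q := Prod.ext (map_mul e₁ p.1 q.1) (map_mul e₂ p.2 q.2)
  continuous_toFun := (e₁.continuous.comp continuous_fst).prodMk (e₂.continuous.comp continuous_snd)
  continuous_invFun := (e₁.symm.continuous.comp continuous_fst).prodMk (e₂.symm.continuous.comp continuous_snd)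

/-- (Ported verbatim from the HodgeCMPerL package; no docstring in the source.) -/
@[simp] theorem prodCongrCME_apply (e₁ : A ≃ₜ* B) (e₂ : C ≃ₜ* D) (p : A × C) :
    prodCongrCME e₁ e₂ p = (e₁ p.1, e₂ p.2) := rfl

end ProdCongr

/-- **THE D3 DICTIONARY** `U(H)(𝔸_{L⁺}) ≃ₜ* (∏_{w ∣ ∞} U(H_w)) × U(H)(𝔸_{L⁺,f})`. -/
def archFinEquiv (hdet : IsUnit H.det) : adelicUnitaryGroup L H ≃ₜ* unitaryPiSubmonoid (cm L) H × Ufin L H :=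
  (splitEquiv L H).trans (prodCongrCME (archEquiv L hdet) (ContinuousMulEquiv.refl _))

/-- (Ported verbatim from the HodgeCMPerL package; no docstring in the source.) -/
theorem archFinEquiv_apply (hdet : IsUnit H.det) (g : adelicUnitaryGroup L H) :
    archFinEquiv L hdet g = (archEquiv L hdet (splitEquiv L H g).1, (splitEquiv L H g).2) := rfl

/-- (Ported verbatim from the HodgeCMPerL package; no docstring in the source.) -/
theorem coe_archFinEquiv_fst (hdet : IsUnit H.det) (g : adelicUnitaryGroup L H) (w : InfinitePlace L) :
    ((archFinEquiv L hdet g).1 : InfinitePlace L → Matrix n n ℂ) w =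
      (((g : GL n (AdeleRing (𝓞 L) L)) : Matrix n n (AdeleRing (𝓞 L) L)).map Prod.fst).map (coordHom L w) := rfl

/-- (Ported verbatim from the HodgeCMPerL package; no docstring in the source.) -/
theorem archFinEquiv_snd (hdet : IsUnit H.det) (g : adelicUnitaryGroup L H) :
    (archFinEquiv L hdet g).2 = (splitEquiv L H g).2 := rfl

variable (H)

/-- **`ιf : U(H)(𝔸_{L⁺,f}) →* U(H)(𝔸_{L⁺})`**, `k ↦ (1, k)` — the field `ιf` of N23c. -/
def ιf : Ufin L H →* adelicUnitaryGroup L H :=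
  (splitEquiv L H).symm.toMulEquiv.toMonoidHom.comp (MonoidHom.inr (Uinf L H) (Ufin L H))

/-- (Ported verbatim from the HodgeCMPerL package; no docstring in the source.) -/
theorem ιf_apply (k : Ufin L H) : ιf L H k = (splitEquiv L H).symm (1, k) := rfl

/-- (Ported verbatim from the HodgeCMPerL package; no docstring in the source.) -/
@[simp] theorem splitEquiv_ιf (k : Ufin L H) : splitEquiv L H (ιf L H k) = (1, k) :=
  (splitEquiv L H).apply_symm_apply (1, k)

/-- (Ported verbatim from the HodgeCMPerL package; no docstring in the source.) -/
theorem val_ιf (k : Ufin L H) (i j : n) :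
    (((ιf L H k : adelicUnitaryGroup L H) : GL n (AdeleRing (𝓞 L) L)) : Matrix n n (AdeleRing (𝓞 L) L)) i j =
      ((1 : Matrix n n (InfiniteAdeleRing L)) i j,
        ((k : GL n (FiniteAdeleRing (𝓞 L) L)) : Matrix n n (FiniteAdeleRing (𝓞 L) L)) i j) := rfl

/-- (Ported verbatim from the HodgeCMPerL package; no docstring in the source.) -/
theorem ιf_injective : Function.Injective (ιf L H) := fun k k' h => by
  have h' := congrArg (fun g => (splitEquiv L H g).2) h
  simpa only [splitEquiv_ιf] using h'

/-- (Ported verbatim from the HodgeCMPerL package; no docstring in the source.) -/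
theorem continuous_ιf : Continuous (ιf L H) :=
  (splitEquiv L H).symm.continuous.comp (continuous_const.prodMk continuous_id)

variable {H}

/-- (Ported verbatim from the HodgeCMPerL package; no docstring in the source.) -/
@[simp] theorem archFinEquiv_ιf (hdet : IsUnit H.det) (k : Ufin L H) : archFinEquiv L hdet (ιf L H k) = (1, k) := by
  rw [archFinEquiv_apply, splitEquiv_ιf, map_one]

/-- The diagonal lift of a rational unitary matrix has archimedean dictionary image `(w(g))_w`. -/
theorem coe_archFinEquiv_toAdeleGL_fst (hdet : IsUnit H.det) {g : GL n L}
    (hg : g ∈ unitaryGroup (conjRingHomK L) H) :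
    ((archFinEquiv L hdet ⟨toAdeleGL L g, toAdeleGL_mem L H hg⟩).1 : InfinitePlace L → Matrix n n ℂ) =
      piMap (cm L) (g : Matrix n n L) := by
  funext w
  rw [coe_archFinEquiv_fst]
  ext i j
  simp only [Matrix.map_apply, val_toAdeleGL]
  exact coordHom_algebraMap L w _

/-- **Rational lift.** Every `g ∈ U(H)(L⁺) ≤ GL_n(L)` is the archimedean image of some `γ ∈ Γ = U(H)(L⁺) ≤ U(H)(𝔸_{L⁺})`
(namely of its diagonal embedding). -/
theorem exists_rat_lift (hdet : IsUnit H.det) (g : GL n L) (hg : g ∈ unitaryGroup (conjRingHomK (cm L)) H) :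
    ∃ γ ∈ adelicUnitaryRat L H,
      ((archFinEquiv L hdet γ).1 : InfinitePlace (cm L) → Matrix n n ℂ) = piMap (cm L) (g : Matrix n n L) :=
  ⟨⟨toAdeleGL L g, toAdeleGL_mem L H hg⟩, (mem_adelicUnitaryRat_iff L H _).2 ⟨g, hg, rfl⟩,
    coe_archFinEquiv_toAdeleGL_fst L hdet hg⟩

/-- **N23c `dense` for the genuine adelic unitary group** (PerL v5 Prop. 3.6 Step 2, ll. 431–433): for a
non-degenerate Hermitian `H` and ANY family `ιA : TA → U(H)(𝔸_{L⁺})` (the adelic torus, or anything), the set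
`U(H)(L⁺) · ιA(TA) · U(H)(𝔸_{L⁺,f})` is dense in `U(H)(𝔸_{L⁺})` — by real approximation at the archimedean places
(pv06-g2 `dense_cosets_of_dictionary`, from [Kneser1966]) transported through the dictionary of this file. -/
theorem dense_cosets (hH : (H.map (conjRingHomK (cm L)))ᵀ = H) (hdet : IsUnit H.det) {TA : Type*}
    (ιA : TA → adelicUnitaryGroup L H) (t₀ : TA) :
    Dense {g : adelicUnitaryGroup L H | ∃ γ ∈ adelicUnitaryRat L H, ∃ (t : TA) (k : Ufin L H), g = γ * ιA t * ιf L H k} :=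
  dense_cosets_of_dictionary (cm L) H hH hdet (archFinEquiv L hdet) (adelicUnitaryRat L H) (ιf L H)
    (archFinEquiv_ιf L hdet) (exists_rat_lift L hdet) ιA t₀

variable (H)

/-- **N23c `comm`**: an element of `U(H)(𝔸_{L⁺})` with trivial finite component commutes with `ιf (U(H)(𝔸_{L⁺,f}))`. -/
theorem ιf_comm (k : Ufin L H) (g : adelicUnitaryGroup L H) (hg : (splitEquiv L H g).2 = 1) :
    ιf L H k * g = g * ιf L H k :=
  commute_of_prod_decomp (splitEquiv L H) (x := ιf L H k) (y := g) (by rw [splitEquiv_ιf]) hg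

/-- `comm`, with the hypothesis on the finite component stated on matrices: `(g_f)_{ij} = δ_{ij}`. -/
theorem ιf_comm_of_map_snd (k : Ufin L H) (g : adelicUnitaryGroup L H)
    (hg : (((g : GL n (AdeleRing (𝓞 L) L)) : Matrix n n (AdeleRing (𝓞 L) L)).map Prod.snd) = 1) :
    ιf L H k * g = g * ιf L H k :=
  ιf_comm L H k g (Subtype.ext (Units.ext (by rw [val_splitEquiv_snd, hg]; rfl)))

end HodgeCM.PerL34.AdelicUnitaryFactorisation

end
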